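import Literature.Geometry.Riemannian.SimpleManifoldBallLocalHomeo
import HarnessLib

/-!
# A simple sublevel domain is homeomorphic to a closed ball (PSU Prop. 3.8.5, first conclusion)

Continuation of `SimpleManifoldBallLocalHomeo.lean` (same setting and notation: compact `M`
modelled on a finite-dimensional real inner product space `E`, `C^∞` Riemannian `g`, `C^∞` `ρ`,
`D = {ρ ≤ 0}` strictly convex, non-trapping, connected and without conjugate points, interior
point `x₀`, `exp = expMap g.leviCivita x₀`, `D_{x₀} = {u | γ_u([0,1]) ⊆ D}`):

* `isLocalHomeomorph_expMap_restrict`: the induced map `p : D_{x₀} → D`, `u ↦ exp u`, is a local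
  homeomorphism (local diffeomorphism of `E` into `M` + the boundary behaviour
  `exists_nhds_mem_expDomain_of_expMap_mem`);
* `exists_homeomorph_expDomain_closedBall`: `D_{x₀} ≃ₜ B̄` (`exists_homeomorph_radial_closedBall` on
  the radial description of `D_{x₀}`);
* `injective_expMap_restrict`: `p` is injective (`injective_of_isLocalHomeomorph_of_homeomorph_closedBall`:
  covering + lifting + Brouwer — the tree's replacement of PSU Prop. 3.8.4);
  `surjective_expMap_restrict`: its image is compact and open in the connected `D`;
* `exists_homeomorph_expDomain_sublevel` (`D_{x₀} ≃ₜ D` by `exp`) and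
  **`exists_homeomorph_sublevel_closedBall`: `D ≃ₜ B̄`** ("In particular, `M` is diffeomorphic to
  a closed ball" — here homeomorphic, Mathlib having no manifolds with boundary to carry `exp_x`
  as a diffeomorphism of such).

No definitions, no named facts.

## References

* G. P. Paternain, M. Salo, G. Uhlmann, *Geometric Inverse Problems* (2023), Prop. 3.8.4,
  Prop. 3.8.5 (PDF pp. 96–97).
-/

noncomputable section

open Bundle Set Filter Function Metric
open scoped Manifold ContDiff Topology

namespace Literature.Geometry.Riemannian

open Literature.Geometry.Lorentzian

variable {E : Type*} [NormedAddCommGroup E] [InnerProductSpace ℝ E] [FiniteDimensional ℝ E]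
  [CompleteSpace E] {M : Type*} [TopologicalSpace M] [ChartedSpace E M]
  [IsManifold 𝓘(ℝ, E) ∞ M] [T2Space M] [CompactSpace M]
  {g : PseudoRiemannianMetric 𝓘(ℝ, E) ∞ E (TangentSpace 𝓘(ℝ, E) : M → Type _)}
  [g.HasLeviCivita] {ρ : M → ℝ} {x₀ : M}

/-- **`exp : D_{x₀} → D` is a local homeomorphism** (of the subspaces): around `u ∈ D_{x₀}` take
the local diffeomorphism `Φ` of `exists_openPartialHomeomorph_expMap` and the neighbourhood `N`
of `exists_nhds_mem_expDomain_of_expMap_mem`; on `V = Φ.source ∩ N`, `exp` maps `V ∩ D_{x₀}`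
bijectively onto the open subset `Φ(V) ∩ D` of `D`, with inverse `Φ⁻¹`.
[cite: PaternainSaloUhlmann2023, Prop. 3.8.5 (proof)] -/
theorem isLocalHomeomorph_expMap_restrict (hg : g.IsRiemannian)
    (hρ : ContMDiff 𝓘(ℝ, E) 𝓘(ℝ, ℝ) ∞ ρ) (hconv : IsStrictlyConvexSublevel g ρ)
    (hnt : IsNonTrappingSublevel g ρ) (hnc : HasNoConjugatePointsSublevel g ρ) (hx₀ : ρ x₀ < 0) :
    IsLocalHomeomorph (fun u : {u : E | ∀ t ∈ Icc (0 : ℝ) 1,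
        ρ (maximalGeodesic g.leviCivita x₀ u t) ≤ 0} ↦
      (⟨expMap g.leviCivita x₀ u.1,
        expMap_mem_sublevel hg u.2⟩ : {y : M | ρ y ≤ 0})) := by
  classical
  set ex : E → M := fun u : E ↦ expMap g.leviCivita x₀ u
    with hex_def
  have hexc : Continuous ex := (contMDiff_expMap_smooth hg).continuous
  set Dx : Set E := {u : E | ∀ t ∈ Icc (0 : ℝ) 1,
    ρ (maximalGeodesic g.leviCivita x₀ u t) ≤ 0} with hDx_def
  set Ds : Set M := {y : M | ρ y ≤ 0} with hDs_def
  set p : Dx → Ds := fun u ↦ ⟨ex u.1, expMap_mem_sublevel hg u.2⟩ with hp_def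
  have hpc : Continuous p := (hexc.comp continuous_subtype_val).subtype_mk _
  refine IsLocalHomeomorph.mk p fun a ↦ ?_
  obtain ⟨Φ, haΦ, hΦapply, -⟩ := exists_openPartialHomeomorph_expMap hg hnc a.2
  obtain ⟨N, hNo, haN, hN⟩ := exists_nhds_mem_expDomain_of_expMap_mem hg hρ hconv hnt hx₀ a.2
  set V : Set E := Φ.source ∩ N with hV_def
  have hVo : IsOpen V := Φ.open_source.inter hNo
  have hVsub : V ⊆ Φ.source := inter_subset_left
  -- for `y = Φ v`, `v ∈ V`, `y ∈ D`: the preimage `Φ⁻¹ y = v` lies in `D_{x₀}`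
  have hback : ∀ (y : Ds) (v : E), v ∈ V → Φ v = y.1 → Φ.symm y.1 = v ∧ v ∈ Dx := by
    intro y v hv hvy
    have h1 : Φ.symm y.1 = v := by rw [← hvy]; exact Φ.left_inv (hVsub hv)
    refine ⟨h1, hN v hv.2 ?_⟩
    rw [← hΦapply v (hVsub hv), hvy]
    exact y.2
  -- the open partial homeomorphism of the subspaces
  let e : OpenPartialHomeomorph Dx Ds :=
    { toFun := p
      invFun := fun y ↦ if h : ∃ v ∈ V, Φ v = y.1 then
          ⟨Φ.symm y.1, by
            obtain ⟨v, hv, hvy⟩ := h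
            obtain ⟨h1, h2⟩ := hback y v hv hvy
            rw [h1]; exact h2⟩
        else a
      source := Subtype.val ⁻¹' V
      target := {y | ∃ v ∈ V, Φ v = y.1}
      map_source' := by
        intro u hu
        exact ⟨u.1, hu, hΦapply u.1 (hVsub hu)⟩
      map_target' := by
        intro y hy
        obtain ⟨v, hv, hvy⟩ := hy
        simp only [dif_pos (show ∃ v ∈ V, Φ v = y.1 from ⟨v, hv, hvy⟩), mem_preimage]
        rw [(hback y v hv hvy).1]
        exact hv
      left_inv' := by
        intro u hu
        have hex : ∃ v ∈ V, Φ v = (p u).1 := ⟨u.1, hu, hΦapply u.1 (hVsub hu)⟩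
        simp only [dif_pos hex]
        apply Subtype.ext
        show Φ.symm (expMap g.leviCivita x₀ u.1) = u.1
        rw [← hΦapply u.1 (hVsub hu)]
        exact Φ.left_inv (hVsub hu)
      right_inv' := by
        intro y hy
        obtain ⟨v, hv, hvy⟩ := hy
        simp only [dif_pos (show ∃ v ∈ V, Φ v = y.1 from ⟨v, hv, hvy⟩)]
        apply Subtype.ext
        show expMap g.leviCivita x₀ (Φ.symm y.1) = y.1
        rw [(hback y v hv hvy).1, ← hΦapply v (hVsub hv), hvy]
      open_source := hVo.preimage continuous_subtype_val
      open_target := by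
        have h : {y : Ds | ∃ v ∈ V, Φ v = y.1} = Subtype.val ⁻¹' (Φ '' V) := by
          ext y; simp [mem_image]
        rw [h]
        exact (Φ.isOpen_image_of_subset_source hVo hVsub).preimage continuous_subtype_val
      continuousOn_toFun := hpc.continuousOn
      continuousOn_invFun := by
        rw [continuousOn_iff_continuous_restrict]
        have hfun : ({y : Ds | ∃ v ∈ V, Φ v = y.1}.restrict fun y : Ds ↦
            if h : ∃ v ∈ V, Φ v = y.1 then
              (⟨Φ.symm y.1, by
                obtain ⟨v, hv, hvy⟩ := h
                obtain ⟨h1, h2⟩ := hback y v hv hvy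
                rw [h1]; exact h2⟩ : Dx)
            else a) =
            fun y ↦ ⟨Φ.symm y.1.1, by
              obtain ⟨v, hv, hvy⟩ := y.2
              obtain ⟨h1, h2⟩ := hback y.1 v hv hvy
              rw [h1]; exact h2⟩ := by
          funext y
          have hy : ∃ v ∈ V, Φ v = (y : Ds).1 := y.2
          rw [restrict_apply, dif_pos hy]
        rw [hfun]
        refine Continuous.subtype_mk ?_ _
        refine Φ.continuousOn_symm.comp_continuous
          (continuous_subtype_val.comp continuous_subtype_val) fun y ↦ ?_
        obtain ⟨v, hv, hvy⟩ := y.2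
        rw [← hvy]
        exact Φ.map_source (hVsub hv) }
  exact ⟨e, show a.1 ∈ V from ⟨haΦ, haN⟩, fun u _ ↦ rfl⟩

/-- **`D_{x₀}` is homeomorphic to the closed unit ball** (radial description
`D_{x₀} = {u | u = 0 ∨ ‖u‖ ≤ s u}` with the continuous, homogeneous, pinched radial function
`s u = R u ‖u‖`, and `exists_homeomorph_radial_closedBall`; PSU: "`D_x` is a closed starshaped domain
around zero … hence diffeomorphic to a closed ball"). [cite: PaternainSaloUhlmann2023, Prop. 3.8.5 (proof)] -/
theorem exists_homeomorph_expDomain_closedBall (hg : g.IsRiemannian)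
    (hρ : ContMDiff 𝓘(ℝ, E) 𝓘(ℝ, ℝ) ∞ ρ) (hconv : IsStrictlyConvexSublevel g ρ)
    (hnt : IsNonTrappingSublevel g ρ) (hx₀ : ρ x₀ < 0) :
    Nonempty ({u : E | ∀ t ∈ Icc (0 : ℝ) 1,
        ρ (maximalGeodesic g.leviCivita x₀ u t) ≤ 0} ≃ₜ
      closedBall (0 : E) 1) := by
  have hρc := hρ.continuous
  obtain ⟨m, M', hm, hb⟩ := exists_bounds_radial hg hρ hconv hnt hx₀ (x₀ := x₀)
  obtain ⟨e, -, -⟩ := exists_homeomorph_radial_closedBall (F := E)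
    (s := fun u : E ↦ sSup {a : ℝ | 0 ≤ a ∧ ∀ t ∈ Icc (0 : ℝ) a,
      ρ (maximalGeodesic g.leviCivita x₀ u t) ≤ 0} * ‖u‖)
    hm (fun u hu ↦ continuousAt_radial hg hρ hconv hnt hx₀ hu)
    (fun c hc u ↦ radial_smul hg hρc hnt hx₀.le hc u) (fun u hu ↦ (hb u hu).1)
    (fun u hu ↦ (hb u hu).2)
  exact ⟨(Homeomorph.setCongr (expDomain_eq_radialSet hg hρc hnt hx₀.le)).trans e⟩

/-- **`exp : D_{x₀} → D` is injective** — the tree's replacement of PSU Prop. 3.8.4 (uniqueness of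
geodesics between two points of a simple manifold, printed via Morse theory): a local homeomorphism
from a space homeomorphic to a closed ball to a Hausdorff space is injective
(`injective_of_isLocalHomeomorph_of_homeomorph_closedBall`: covering + lifting criterion + Brouwer).
[cite: PaternainSaloUhlmann2023, Prop. 3.8.4] -/
theorem injective_expMap_restrict (hg : g.IsRiemannian)
    (hρ : ContMDiff 𝓘(ℝ, E) 𝓘(ℝ, ℝ) ∞ ρ) (hconv : IsStrictlyConvexSublevel g ρ)
    (hnt : IsNonTrappingSublevel g ρ) (hnc : HasNoConjugatePointsSublevel g ρ) (hx₀ : ρ x₀ < 0) :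
    Injective (fun u : {u : E | ∀ t ∈ Icc (0 : ℝ) 1,
        ρ (maximalGeodesic g.leviCivita x₀ u t) ≤ 0} ↦
      (⟨expMap g.leviCivita x₀ u.1,
        expMap_mem_sublevel hg u.2⟩ : {y : M | ρ y ≤ 0})) := by
  obtain ⟨e⟩ := exists_homeomorph_expDomain_closedBall hg hρ hconv hnt hx₀ (x₀ := x₀)
  exact injective_of_isLocalHomeomorph_of_homeomorph_closedBall e
    (isLocalHomeomorph_expMap_restrict hg hρ hconv hnt hnc hx₀)

/-- **`exp : D_{x₀} → D` is surjective** when `D` is connected: `D_{x₀}` is compact, so the image is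
compact hence closed in `D`; it is open (local homeomorphisms are open maps) and non-empty
(`0 ↦ x₀`); `D` is connected. (PSU obtains surjectivity from Prop. 3.7.21, existence of geodesics in
`M` between any two points.) [cite: PaternainSaloUhlmann2023, Prop. 3.7.21 and Prop. 3.8.4] -/
theorem surjective_expMap_restrict (hg : g.IsRiemannian)
    (hρ : ContMDiff 𝓘(ℝ, E) 𝓘(ℝ, ℝ) ∞ ρ) (hconv : IsStrictlyConvexSublevel g ρ)
    (hnt : IsNonTrappingSublevel g ρ) (hnc : HasNoConjugatePointsSublevel g ρ)
    (hconn : IsConnected {y : M | ρ y ≤ 0}) (hx₀ : ρ x₀ < 0) :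
    Surjective (fun u : {u : E | ∀ t ∈ Icc (0 : ℝ) 1,
        ρ (maximalGeodesic g.leviCivita x₀ u t) ≤ 0} ↦
      (⟨expMap g.leviCivita x₀ u.1,
        expMap_mem_sublevel hg u.2⟩ : {y : M | ρ y ≤ 0})) := by
  haveI : CompactSpace {u : E | ∀ t ∈ Icc (0 : ℝ) 1,
      ρ (maximalGeodesic g.leviCivita x₀ u t) ≤ 0} :=
    isCompact_iff_compactSpace.1 (isCompact_expDomain hg hρ hconv hnt hx₀)
  haveI : ConnectedSpace {y : M | ρ y ≤ 0} := Subtype.connectedSpace hconn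
  haveI : Nonempty {u : E | ∀ t ∈ Icc (0 : ℝ) 1,
      ρ (maximalGeodesic g.leviCivita x₀ u t) ≤ 0} :=
    ⟨⟨0, expDomainInterior_subset_expDomain (zero_mem_expDomainInterior hg hx₀)⟩⟩
  have hp := isLocalHomeomorph_expMap_restrict hg hρ hconv hnt hnc hx₀ (x₀ := x₀)
  have hclosed := (isCompact_range hp.continuous).isClosed
  have hopen := hp.isOpenMap.isOpen_range
  have huniv := IsClopen.eq_univ ⟨hclosed, hopen⟩ (range_nonempty _)
  intro y
  have hy : y ∈ range (fun u : {u : E | ∀ t ∈ Icc (0 : ℝ) 1,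
        ρ (maximalGeodesic g.leviCivita x₀ u t) ≤ 0} ↦
      (⟨expMap g.leviCivita x₀ u.1,
        expMap_mem_sublevel hg u.2⟩ : {y : M | ρ y ≤ 0})) := by
    rw [huniv]; exact mem_univ y
  exact hy

/-- **`exp : D_{x₀} → D` is a homeomorphism** for a simple connected sublevel domain (bijective local
homeomorphism; PSU Prop. 3.8.5: "`exp_x : D_x → M` is a diffeomorphism").
[cite: PaternainSaloUhlmann2023, Prop. 3.8.5] -/
theorem exists_homeomorph_expDomain_sublevel (hg : g.IsRiemannian)
    (hρ : ContMDiff 𝓘(ℝ, E) 𝓘(ℝ, ℝ) ∞ ρ) (hconv : IsStrictlyConvexSublevel g ρ)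
    (hnt : IsNonTrappingSublevel g ρ) (hnc : HasNoConjugatePointsSublevel g ρ)
    (hconn : IsConnected {y : M | ρ y ≤ 0}) (hx₀ : ρ x₀ < 0) :
    ∃ h : {u : E | ∀ t ∈ Icc (0 : ℝ) 1,
        ρ (maximalGeodesic g.leviCivita x₀ u t) ≤ 0} ≃ₜ
      {y : M | ρ y ≤ 0},
      ∀ u, (h u : M) = expMap g.leviCivita x₀ u.1 := by
  have hp := isLocalHomeomorph_expMap_restrict hg hρ hconv hnt hnc hx₀ (x₀ := x₀)
  refine ⟨hp.toHomeomorphOfBijective ⟨injective_expMap_restrict hg hρ hconv hnt hnc hx₀,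
    surjective_expMap_restrict hg hρ hconv hnt hnc hconn hx₀⟩, fun u ↦ rfl⟩

/-- **A simple connected sublevel domain is homeomorphic to the closed unit ball**
(Paternain–Salo–Uhlmann 2023, Prop. 3.8.5: "In particular, `M` is diffeomorphic to a closed
ball"; here, Mathlib having no manifolds with boundary to state the diffeomorphism of, the
homeomorphism `D ≃ₜ D_{x₀} ≃ₜ B̄`). [cite: PaternainSaloUhlmann2023, Prop. 3.8.5] -/
theorem exists_homeomorph_sublevel_closedBall (hg : g.IsRiemannian)
    (hρ : ContMDiff 𝓘(ℝ, E) 𝓘(ℝ, ℝ) ∞ ρ) (hconv : IsStrictlyConvexSublevel g ρ)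
    (hnt : IsNonTrappingSublevel g ρ) (hnc : HasNoConjugatePointsSublevel g ρ)
    (hconn : IsConnected {y : M | ρ y ≤ 0}) (hx₀ : ρ x₀ < 0) :
    Nonempty ({y : M | ρ y ≤ 0} ≃ₜ closedBall (0 : E) 1) := by
  obtain ⟨h, -⟩ := exists_homeomorph_expDomain_sublevel hg hρ hconv hnt hnc hconn hx₀ (x₀ := x₀)
  obtain ⟨e⟩ := exists_homeomorph_expDomain_closedBall hg hρ hconv hnt hx₀ (x₀ := x₀)
  exact ⟨h.symm.trans e⟩

end Literature.Geometry.Riemannian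

end
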